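import Summits.BirchSwinnertonDyer.BirchSwinnertonDyer.Theorems.GoldfeldAllTwistsTwoConverseTwinQuarterTracePartnerFieldAlphaGalois
import Summits.BirchSwinnertonDyer.BirchSwinnertonDyer.Theorems.GoldfeldAllTwistsTwoConverseTwinQuarterTraceSignaturesEF
import Summits.BirchSwinnertonDyer.BirchSwinnertonDyer.Theorems.GoldfeldAllTwistsTwoConverseTwinQuarterTraceCosetDifference
import Summits.BirchSwinnertonDyer.BirchSwinnertonDyer.Theorems.GoldfeldAllTwistsTwoConverseTwinQuarterTraceSignaturesEFAlpha
import Summits.BirchSwinnertonDyer.BirchSwinnertonDyer.Theorems.GoldfeldAllTwistsTwoConverseTwinQuarterTracePartnerFieldAlphaGaloisModFourAlpha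
import Summits.BirchSwinnertonDyer.BirchSwinnertonDyer.Theorems.GoldfeldAllTwistsTwoConverseTwinQuarterTracePartnerPHeightModFour
import Summits.BirchSwinnertonDyer.BirchSwinnertonDyer.Theorems.GoldfeldAllTwistsTwoConverseTwinQuarterTracePartnerFieldAlphaGaloisPlusModFourAlpha
import HarnessLib

set_option linter.dupNamespace false -- namespace `…BirchSwinnertonDyer.BirchSwinnertonDyer…` is the cell's (D-0017 nested layout)
set_option autoImplicit false

/-!
# ORDER (ccclxxxii) tranche T2 = E⁺-2: `…QuarterTraceSignaturesEFAlphaPlusModFourAlpha` — the type-α partner field's half-trace package at `(p/q) = +1`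

Cell `bsd-goldfeld`, seat `bsd-goldfeld-s1p-c3x` (gen 15). OBJECT A7⁺ = cells a71+ ∪ a75+ (type α, `q ≡ 7 (mod 8)`, `(q/7) = −1`; `p ≡ 1 (mod 4)`,
`(−7/p) = +1`, `−7 ∉ 𝔽_p^{×4}`; **`(p/q) = +1`**). PLUS TWIN of C7A-P's `exists_partnerField_packageF_alpha_modFourAlpha`
(`…QuarterTraceSignaturesEFAlphaModFourAlpha`): statement letter-identical EXCEPT the binder `h4e : ∀ Δ, Δ.D = −qp → ¬ 4 ∣ #Cl(𝒪_Δ)`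
↦ **`hpq : jacobiSym p q = 1`** and the first conjunct **`Odd κ′` ↦ `Even κ′`** (fed by E⁺-1 `exists_partnerField_data_alpha_galois_plusModFourAlpha`):
the half-trace law is `τ′Φ = κ′T − Φ` with `κ′ = #Cl(F)²` EVEN. The proof is the source's verbatim (the genus involution `g̃`, `2Φ = Tr + P′`,
the torsion clause `n•t′ ≠ T`, the Galois clauses are parity-free).
`--supports stmt-BirchSwinnertonDyer-20044 --as helper`. Theses-free; theorems only; no definition, no new fact, no `sorry`. Binders BY NAME as in
the source. FRONTIER-grade: twist-density-ZERO sub-family modulo named print; never distance-to-summit. HONEST FRAMING: items 19140 / 20044 unchanged;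
BSD is not proved by any of this.
-/


noncomputable section

open scoped Classical IntermediateField

open WeierstrassCurve Literature.NumberTheory.EllipticCurves Literature.NumberTheory.EllipticCurves.ModularForms
  Literature.NumberTheory.EllipticCurves.CaiShuTian2014 Literature.NumberTheory.EllipticCurves.CoatesLiTianZhai2015
  Literature.Computability.Cryptography.Hallgren2005

namespace Summit.BirchSwinnertonDyer.BirchSwinnertonDyer.Theorems.GoldfeldGoodTwists

-- the cell's point-group world over `F[1]` / `ℂ` (X3α-3a's); file-local
attribute [local instance 2000] Classical.propDecidable

/-! ## The type-α partner field's half-trace package in `X₀(49)(F[1])` -/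
section PartnerField

variable {F : Type} [Field F] [NumberField F] (ιF : F →+* ℂ) [FiniteDimensional F (ringClassField F ιF 1)]
  [IsGalois F (ringClassField F ιF 1)] [NumberField (ringClassField F ιF 1)]

set_option maxHeartbeats 400000 in
/-- **The type-α partner field's half-trace package at `(p/q) = +1`.** Binders of E⁺-1's `exists_partnerField_data_alpha_galois_plusModFourAlpha` plus `hFS`.
CONCLUSION: EVEN `κ′`, odd `M′`, `r′` with `(r′ : ℂ) = z_p`, the genus involution `g̃` (`g̃r′ = −r′`), complex conjugation `τ′`, and points
`Φ, Tr, P′, Y′, t′ ∈ X₀(49)(F[1])` with: `e_F Φ, e_F P′, e_F Y′ ∈ B`; `2Φ = Tr + P′`; `Tr = (P₂)_{F[1]}`; `M′P′ = (2w)Y′ + t′` (`w` odd), `t′` torsion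
and `n•t′ ≠ T` for every odd `n`; `Φ`, `Y′` fixed by `Stab(r′)`; `g̃Φ = Tr − Φ`, `g̃Y′ = T − Y′`; `τ′Φ = κ′T − Φ`, `τ′Y′ = T − Y′`.
[cite: Gross1984, §§4–5] [cite: GrossLMS1991, Prop. 5.3] [cite: CoatesLiTianZhai2015, Thm. 1.3, 1.4, 4.4 and (2.8)] [cite: Cox2013, §6.A Thm. 6.1] -/
theorem exists_partnerField_packageF_alpha_plusModFourAlpha (hEta₀ : x049_x_sub_two_eq_etaQuotient)
    (hD : deuring_etaQuotient49_heegner_generates_conjPrime) (hEta : x049_heegner_norm_x_sub_two_not_mem)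
    (h14 : thm14_rankOne_twist) (hCST : thm11_ringClassChar)
    (hGZ : ∀ (N : ℕ) [NeZero N] (W : WeierstrassCurve ℚ) (K : Type) [Field K] [NumberField K], gross_zagier N W K)
    (h44 : thm44_ord_two_LAlg) (hBT : burungaleTian_analyticRank_eq_zero_of_selmerCorank_eq_zero_of_hasCM)
    (hBF : bsdTriple_of_hasCM_of_L_one_ne_zero) (hnew : exists_isNewformOf)
    (hGZK : rank_eq_analyticRank_of_analyticRank_le_one) (hF : IsImaginaryQuadratic F)
    {q p : ℕ} (hq : q.Prime) (h3 : 3 < q) (hq4 : q % 4 = 3) (hq7 : jacobiSym q 7 = -1)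
    [Fact p.Prime] (hp4 : p % 4 = 1) (hp7 : legendreSym p (-7) = 1) (hα : ¬ ∃ x : ZMod p, x ^ 4 = -7)
    (hpq : jacobiSym (p : ℤ) q = 1)
    (hdF : NumberField.discr F = -((q : ℤ) * p))
    (D₀ : ModularParametrizationData cm7 49) (hc : |D₀.c| = 1) (hw : cm7.rootNumber = 1)
    (h0 : ∃ h, D₀.cuspZeroPoint = Affine.Point.some 2 (-1) h)
    (H₂ : HeegnerDatum 49 (NumberField.discr F)) (P₂ : (cm7.baseChange F).toAffine.Point)
    (hP₂ : Affine.Point.map ιF.toRatAlgHom P₂ = heegnerPointComplex D₀ H₂)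
    {zq zp : ℂ} (hzq : zq ^ 2 = -(q : ℂ)) (hzp : zp ^ 2 = (p : ℂ)) (κ : F) (hκ : ιF κ = zq * zp)
    (B : AddSubgroup (cm7.baseChange ℂ).toAffine.Point) (S : Subfield ℂ)
    (hBS : ∀ (E : Type) [Field E] [CharZero E] (e : E →+* ℂ), e.fieldRange ≤ S →
      ∀ z : (cm7.baseChange E).toAffine.Point, Affine.Point.map (W' := cm7) e.toRatAlgHom z ∈ B)
    (hSq : zq ∈ S) (hSp : zp ∈ S) (hFS : ∀ x : F, ιF x ∈ S) :
    ∃ (κ' : ℕ) (M' w : ℤ) (r' : ringClassField F ιF 1) (g : ringClassField F ιF 1 ≃ₐ[F] ringClassField F ιF 1)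
      (τ' : ringClassField F ιF 1 ≃ₐ[ℚ] ringClassField F ιF 1) (Φ₁ Tr₁ P'₁ Y' t' : (cm7.baseChange (ringClassField F ιF 1)).toAffine.Point),
      Even κ' ∧ Odd M' ∧ Odd w ∧ (∀ x : ringClassField F ιF 1, ((τ' x : ringClassField F ιF 1) : ℂ) = starRingEnd ℂ x) ∧
      (r' : ℂ) = zp ∧ g r' = -r' ∧
      Affine.Point.map (W' := cm7) (ringClassField F ιF 1).subtype.toRatAlgHom Φ₁ ∈ B ∧
      Affine.Point.map (W' := cm7) (ringClassField F ιF 1).subtype.toRatAlgHom P'₁ ∈ B ∧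
      Affine.Point.map (W' := cm7) (ringClassField F ιF 1).subtype.toRatAlgHom Y' ∈ B ∧
      (2 : ℤ) • Φ₁ = Tr₁ + P'₁ ∧ Tr₁ = Affine.Point.map (W' := cm7) (algebraMap F (ringClassField F ιF 1)).toRatAlgHom P₂ ∧
      M' • P'₁ = (2 * w) • Y' + t' ∧ IsOfFinAddOrder t' ∧
      (∀ n : ℤ, Odd n → n • t' ≠ Affine.Point.some 2 (-1) (nonsingular_cm7_baseChange_two_neg_one (ringClassField F ιF 1))) ∧
      (∀ σ : ringClassField F ιF 1 ≃ₐ[F] ringClassField F ιF 1, σ r' = r' →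
        Affine.Point.map (σ : ringClassField F ιF 1 →ₐ[F] ringClassField F ιF 1) Φ₁ = Φ₁) ∧
      (∀ σ : ringClassField F ιF 1 ≃ₐ[F] ringClassField F ιF 1, σ r' = r' →
        Affine.Point.map (σ : ringClassField F ιF 1 →ₐ[F] ringClassField F ιF 1) Y' = Y') ∧
      Affine.Point.map (g : ringClassField F ιF 1 →ₐ[F] ringClassField F ιF 1) Φ₁ = Tr₁ - Φ₁ ∧
      Affine.Point.map (g : ringClassField F ιF 1 →ₐ[F] ringClassField F ιF 1) Y' =
        Affine.Point.some 2 (-1) (nonsingular_cm7_baseChange_two_neg_one (ringClassField F ιF 1)) - Y' ∧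
      Affine.Point.map (τ' : ringClassField F ιF 1 →ₐ[ℚ] ringClassField F ιF 1) Φ₁ =
        (κ' : ℤ) • Affine.Point.some 2 (-1) (nonsingular_cm7_baseChange_two_neg_one (ringClassField F ιF 1)) - Φ₁ ∧
      Affine.Point.map (τ' : ringClassField F ιF 1 →ₐ[ℚ] ringClassField F ιF 1) Y' =
        Affine.Point.some 2 (-1) (nonsingular_cm7_baseChange_two_neg_one (ringClassField F ιF 1)) - Y' := by
  haveI : (cm7.baseChange (ringClassField F ιF 1)).IsElliptic := by rw [WeierstrassCurve.baseChange]; infer_instance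
  have hp : p.Prime := Fact.out
  obtain ⟨κ', M', w, r', τ', y₁, Y', t', hκ', hM', hw, hτ', hr'F, hr'0, hr'S, hr'C, htrF, hΦ₁, hY'τ, hY'fix, hY'gal,
    ⟨x₁, w₁, hxw, hy₁, hX2F⟩, hY'B, ht', hrel'⟩ :=
    exists_partnerField_data_alpha_galois_plusModFourAlpha ιF hEta₀ hD hEta h14 hCST hGZ h44 hBT hBF hnew hGZK hF hq h3 hq4 hq7 hp4 hp7 hα hpq hdF
      D₀ hc hw h0 H₂ P₂ hP₂ hzq hzp κ hκ B S hBS hSq hSp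
  ------------------------------------------------------------------ the three sums (value-level `set`s) and `2Φ = Tr + P′`
  set eF := Affine.Point.map (W' := cm7) (ringClassField F ιF 1).subtype.toRatAlgHom with heF
  set Φ₁ : (cm7.baseChange (ringClassField F ιF 1)).toAffine.Point := ∑ σ : ringClassField F ιF 1 ≃ₐ[F] ringClassField F ιF 1,
    (if σ r' = r' then (1 : ℤ) else 0) • Affine.Point.map (σ : ringClassField F ιF 1 →ₐ[F] ringClassField F ιF 1) y₁ with hΦ₁def
  set Tr₁ : (cm7.baseChange (ringClassField F ιF 1)).toAffine.Point := ∑ σ : ringClassField F ιF 1 ≃ₐ[F] ringClassField F ιF 1,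
    Affine.Point.map (σ : ringClassField F ιF 1 →ₐ[F] ringClassField F ιF 1) y₁ with hTr₁def
  set P'₁ : (cm7.baseChange (ringClassField F ιF 1)).toAffine.Point := ∑ σ : ringClassField F ιF 1 ≃ₐ[F] ringClassField F ιF 1,
    (if σ r' = r' then (1 : ℤ) else -1) • Affine.Point.map (σ : ringClassField F ιF 1 →ₐ[F] ringClassField F ιF 1) y₁ with hP'₁def
  have h2Φ₁ : (2 : ℤ) • Φ₁ = Tr₁ + P'₁ := two_zsmul_halfSum_eq _ _
  ------------------------------------------------------------------ `Φ`, `P′` are `Stab(r′)`-fixed, hence defined over `F(r′) ⊂ S`: memberships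
  have hΦ₁fix : ∀ σ : ringClassField F ιF 1 ≃ₐ[F] ringClassField F ιF 1, σ r' = r' →
      Affine.Point.map (σ : ringClassField F ιF 1 →ₐ[F] ringClassField F ιF 1) Φ₁ = Φ₁ := fun σ hσ ↦
    map_sum_smul_map_eq_of_mul_invariant σ _ (fun σ' ↦ by rw [mul_apply_sqrt_eq_iff_of_apply_eq σ σ' hr'F hσ]) y₁
  have hP'₁fix : ∀ σ : ringClassField F ιF 1 ≃ₐ[F] ringClassField F ιF 1, σ r' = r' →
      Affine.Point.map (σ : ringClassField F ιF 1 →ₐ[F] ringClassField F ιF 1) P'₁ = P'₁ := fun σ hσ ↦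
    map_sum_smul_map_eq_of_mul_invariant σ _ (fun σ' ↦ by rw [mul_apply_sqrt_eq_iff_of_apply_eq σ σ' hr'F hσ]) y₁
  have hFS' : ∀ x : F, (ringClassField F ιF 1).subtype (algebraMap F (ringClassField F ιF 1) x) ∈ S := fun x ↦ by
    rw [Subfield.coe_subtype, coe_algebraMap_ringClassField]; exact hFS x
  have hSp' : (ringClassField F ιF 1).subtype r' ∈ S := by rw [Subfield.coe_subtype]; exact hr'S
  have hBF : ∀ X : (cm7.baseChange (ringClassField F ιF 1)).toAffine.Point,
      (∀ σ : ringClassField F ιF 1 ≃ₐ[F] ringClassField F ιF 1, σ r' = r' →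
        Affine.Point.map (σ : ringClassField F ιF 1 →ₐ[F] ringClassField F ιF 1) X = X) → eF X ∈ B := by
    intro X hX
    obtain ⟨z, hz⟩ := exists_map_adjoin_eq_of_forall_fixing cm7 (k := F) r' hX
    have hle : ((ringClassField F ιF 1).subtype.comp (algebraMap (F⟮r'⟯) (ringClassField F ιF 1))).fieldRange ≤ S := by
      intro w hw
      obtain ⟨y, rfl⟩ := RingHom.mem_fieldRange.mp hw
      exact algebraMap_adjoin_mem_of_mem (F₀ := F) (ringClassField F ιF 1).subtype S hFS' (r := r') hSp' y
    have hmem := hBS _ _ hle z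
    have e : Affine.Point.map (W' := cm7) ((ringClassField F ιF 1).subtype.comp (algebraMap (F⟮r'⟯) (ringClassField F ιF 1))).toRatAlgHom z =
        eF X := by
      rw [heF, ← hz]; cases z <;> rfl
    rwa [e] at hmem
  have hΦB : eF Φ₁ ∈ B := hBF Φ₁ hΦ₁fix
  have hP'B : eF P'₁ ∈ B := hBF P'₁ hP'₁fix
  ------------------------------------------------------------------ the genus involution `g̃` and complex conjugation `τ′` on `Φ`, `Y′`
  obtain ⟨g, hg⟩ := exists_algEquiv_apply_sqrt_eq_neg hr'F (not_isSquare_natCast_of_discr_negTwoPrimes hF hq hp hdF)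
  have hg' : g⁻¹ r' = -r' := by
    have e : g⁻¹ (g r') = r' := by rw [← AlgEquiv.mul_apply, inv_mul_cancel, AlgEquiv.one_apply]
    rw [hg, map_neg] at e
    exact neg_eq_iff_eq_neg.mp e
  have hgΦ : Affine.Point.map (g : ringClassField F ιF 1 →ₐ[F] ringClassField F ιF 1) Φ₁ = Tr₁ - Φ₁ := by
    rw [hΦ₁def, map_sum_smul_map_eq_sum_inv_mul, eq_sub_iff_add_eq, hTr₁def]
    have hne : ∀ σ : ringClassField F ιF 1 ≃ₐ[F] ringClassField F ιF 1, (σ r' = -r' ↔ ¬ σ r' = r') := fun σ ↦ by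
      have hne' : -r' ≠ r' := fun h ↦ hr'0 (CharZero.neg_eq_self_iff.mp h)
      rcases apply_sqrt_eq_self_or_neg σ hr'F with h | h
      · rw [h]; exact ⟨fun h' ↦ absurd h' hne'.symm, fun h' ↦ absurd rfl h'⟩
      · rw [h]; exact ⟨fun _ ↦ hne', fun _ ↦ rfl⟩
    have e : ∀ σ : ringClassField F ιF 1 ≃ₐ[F] ringClassField F ιF 1, ((g⁻¹ * σ) r' = r') = (σ r' = -r') := fun σ ↦
      propext (mul_apply_sqrt_eq_iff_of_apply_eq_neg g⁻¹ σ hr'F hr'0 hg')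
    simp_rw [e]
    exact sum_indicator_not_add (fun σ : ringClassField F ιF 1 ≃ₐ[F] ringClassField F ιF 1 ↦ σ r' = r') (fun σ ↦ σ r' = -r') hne _
  have hgY : Affine.Point.map (g : ringClassField F ιF 1 →ₐ[F] ringClassField F ιF 1) Y' =
      Affine.Point.some 2 (-1) (nonsingular_cm7_baseChange_two_neg_one (ringClassField F ιF 1)) - Y' := eq_sub_of_add_eq' (hY'gal g hg)
  have hτ'Φ : Affine.Point.map (τ' : ringClassField F ιF 1 →ₐ[ℚ] ringClassField F ιF 1) Φ₁ =
      (κ' : ℤ) • Affine.Point.some 2 (-1) (nonsingular_cm7_baseChange_two_neg_one (ringClassField F ιF 1)) - Φ₁ := by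
    rw [eq_sub_iff_add_eq, add_comm, natCast_zsmul]; exact hΦ₁
  have hτ'Y : Affine.Point.map (τ' : ringClassField F ιF 1 →ₐ[ℚ] ringClassField F ιF 1) Y' =
      Affine.Point.some 2 (-1) (nonsingular_cm7_baseChange_two_neg_one (ringClassField F ιF 1)) - Y' := eq_sub_of_add_eq' hY'τ
  ------------------------------------------------------------------ no odd multiple of `t′` is `T` (K8's descent lemma + X2 at `F`)
  have hθ : ∀ n : ℤ, Odd n → n • t' ≠ Affine.Point.some 2 (-1) (nonsingular_cm7_baseChange_two_neg_one (ringClassField F ιF 1)) := by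
    intro n hn hnt'
    -- `n • t′ = T`: then `(nM′) • P′ = 2 • (2nk′ • Y′) + T`
    have hsum : (n * M') • P'₁ = (2 : ℤ) • ((n * w) • Y') +
        Affine.Point.some 2 (-1) (nonsingular_cm7_baseChange_two_neg_one (ringClassField F ιF 1)) := by
      rw [← hnt', mul_zsmul, hrel', zsmul_add, smul_smul, smul_smul]
      congr 2; ring
    -- the signed full sum as a sum of affine points with abscissae `σ x₁`
    have hmapσ : ∀ σ : ringClassField F ιF 1 ≃ₐ[F] ringClassField F ιF 1, ∃ hσ,
        Affine.Point.map (σ : ringClassField F ιF 1 →ₐ[F] ringClassField F ιF 1) (Affine.Point.some x₁ w₁ hxw) =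
          Affine.Point.some (σ x₁) (σ w₁) hσ := fun σ ↦ ⟨_, Affine.Point.map_some _ _⟩
    choose hσ hmapσ' using hmapσ
    set Yσ : (ringClassField F ιF 1 ≃ₐ[F] ringClassField F ιF 1) → ringClassField F ιF 1 := fun σ ↦
      if σ r' = r' then σ w₁ else (cm7.baseChange (ringClassField F ιF 1)).toAffine.negY (σ x₁) (σ w₁) with hYσ
    have hns : ∀ σ : ringClassField F ιF 1 ≃ₐ[F] ringClassField F ιF 1,
        (cm7.baseChange (ringClassField F ιF 1)).toAffine.Nonsingular (σ x₁) (Yσ σ) := fun σ ↦ by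
      by_cases h : σ r' = r'
      · rw [hYσ]; simp only [h, if_true]; exact hσ σ
      · rw [hYσ]; simp only [h, if_false]; exact (Affine.nonsingular_neg _ _).mpr (hσ σ)
    have hterm : ∀ σ : ringClassField F ιF 1 ≃ₐ[F] ringClassField F ιF 1, (if σ r' = r' then (1 : ℤ) else -1) •
        Affine.Point.map (σ : ringClassField F ιF 1 →ₐ[F] ringClassField F ιF 1) y₁ = Affine.Point.some (σ x₁) (Yσ σ) (hns σ) := by
      intro σ
      by_cases h : σ r' = r'
      · simp only [h, if_true, hYσ, one_zsmul, hy₁]; rw [hmapσ' σ]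
      · simp only [h, if_false, hYσ, neg_one_zsmul, hy₁]; rw [hmapσ' σ, Affine.Point.neg_some]
    have hsum' : (n * M') • ∑ σ ∈ (Finset.univ : Finset (ringClassField F ιF 1 ≃ₐ[F] ringClassField F ιF 1)),
        Affine.Point.some (σ x₁) (Yσ σ) (hns σ) =
          (2 : ℤ) • ((n * w) • Y') + Affine.Point.some 2 (-1) (nonsingular_cm7_baseChange_two_neg_one (ringClassField F ιF 1)) := by
      rw [← hsum, hP'₁def]
      exact congrArg _ (Finset.sum_congr rfl fun σ _ ↦ (hterm σ).symm)
    have hx : ∀ σ ∈ (Finset.univ : Finset (ringClassField F ιF 1 ≃ₐ[F] ringClassField F ιF 1)), σ x₁ ≠ 2 := by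
      intro σ _ hσ2
      apply hX2F {σ}
      rw [Finset.prod_singleton, hσ2, sub_self, mul_zero]
      exact ⟨0, by ring⟩
    exact hX2F Finset.univ (isSquare_seven_mul_prod_of_odd_zsmul_sum_eq_two_zsmul_add_twoTorsion _ hns hx (hn.mul hM') _ hsum')
  exact ⟨κ', M', w, r', g, τ', Φ₁, Tr₁, P'₁, Y', t', hκ', hM', hw, hτ', hr'C, hg, hΦB, hP'B, hY'B, h2Φ₁, htrF.symm, hrel', ht', hθ,
    hΦ₁fix, hY'fix, hgΦ, hgY, hτ'Φ, hτ'Y⟩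

end PartnerField

end Summit.BirchSwinnertonDyer.BirchSwinnertonDyer.Theorems.GoldfeldGoodTwists

end
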